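import Mathlib

/-!
# EriceRemainderEnclosureHistoryAutonomyComparisonAgeCompositionHarnack — (E71c) KEY FROM THE HARNACK LOAD: in route (N) ((E71a)∕(E71b)) the level hypothesis
# KEY «the surplus `v` of the older ages is a supersolution of the young kernel, `K_y v ≤ v`» follows at every pin `m` from ONE scalar inequality between the
# young damped load `x̃_m`, the old mass inside the young window `Ω_m` and the HARNACK LOAD `S_m = Σ_k θ̂_k(m;y)·d_k(m)` (old drops weighted by their
# persistence defects over the young window): `x̃_m·(v_m + S_m) ≤ (1 − Ω_m)·v_m`; the engine is the `l`-STEP HARNACK INEQUALITY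
# `v_{m+l} ≤ v_m + (old reads inside the first l lags) + Σ_k θ̂_k(m;l)·d_k^{≥l}(m)`, which uses nothing but `v ≥ 0` and the persistence of each age's read
# weights under a pin shift

Cell `pub-balaban`, β-function sub-cell, BINDER row D4 «RemainderConst leaves for Bałaban's split» (`HOME/BINDER-OWNERS.md`; owner lineage `b2b-balaban-beta-an4`;
this file by co-owner #2 lineage `b2b-balaban-beta-d4-p2`, generation 62), β-FLOW TEAM duty (1), FREEZE (0) honoured (def-free; Mathlib only; nothing restated).
Companion of (E71a) `…ComparisonAgeComposition` and (E71b) `…ComparisonAgeCompositionInduction` (same abstract language; the per-age read weights `E k m i`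
— age `k`, pin `m`, target depth `m+1+i` — refine (E71a)'s kernels `K m i = Σ_k E k m i`).

HONEST FRAMING (page 1, verbatim and binding).  *"Discharging BetaPertH makes Bałaban's UV stability UNCONDITIONAL — a real constructive-QFT result; it is
NOT the continuum limit and NOT the Clay problem."*  THIS FILE DISCHARGES NOTHING OF THE KIND.  Elementary real analysis about ABSTRACT real sequences and
triangular systems — hypotheses of a census, not facts; the form, signs, ages and moments of Bałaban's (1.22) limit functional are NOT PRINTED ([I] p. 298;
GAPS G-t4-U2-1∕-2) and NOT asserted.  Row D4 class UNCHANGED (critical-path width 0; instance 0∕1; D4 DISCHARGE NO DATE).  HONEST DEPENDENCY: continuum YM on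
T⁴ ⇐ BetaPertH ∧ nine spine estimates (0/9 proved); BetaPertH ⇐ (D1) ∧ (D4) ∧ CAP+tail; G-an2-4 gates asym, D1 and NE2/3/4.

THE POINT (census sense (α); the COMPARISON column, conjecture (E58′), route (N) of `HOME/b2b-balaban-beta-d4-p2/g62/e71/README.md`).  Along the base orbit the
age-`k` part of the first-order kernel reads the target depth `m+1+i` (`i < k`) with the weight `E k m i = (L_k h_{m+k}³∕2)·Π_{t=m+1+i}^{m+k} g_t`; moving the
pin `l` steps deeper changes the weight on a COMMON target by the factor `1 − θ̂_k(m;l) = (h_{m+k+l}∕h_{m+k})³·Π_{t=m+k+1}^{m+k+l} g_t ∈ ]0,1]` (coefficient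
decay times the extra damping), INDEPENDENT of the target and non-increasing in `l` — this is the persistence hypothesis `(1 − θ k m l)·E k m (i+l) ≤
E k (m+l) i` of §1.  §2 `harnack_step`: since `v = w − Σ_k d_k` with `w` non-increasing, `v_{m+l} − v_m ≤ D(m) − D(m+l)`, and each old drop persists,
`d_k(m+l) ≥ (1 − θ̂_k(m;l))·d_k^{≥l}(m)` (`drop_shift_ge`, dropping only non-negative terms) — so the old surplus can rise over `l` steps by at most the old
reads of the first `l` lags plus the defect-weighted tails.  §3: with `V = max_{1≤l≤y} v_{m+l}`, `(1 − Ω_m)·V ≤ v_m + S_m` (`window_max_le`), and the young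
read is `≤ x̃_m·V`; hence **`key_of_harnack_load`**: `x̃_m(v_m + S_m) ≤ (1 − Ω_m)v_m ⟹ K_y v ≤ v` at `m`.  For the flow (E65a)'s window budget at the young
scale gives `Ω_m + x̃_m ≤ √2·(Σ_{k∈O} x_k S_{k,y}∕k + x_y S_{y,y}∕y) ≤ √2∕2` (`S_{k,y} ≥ y∕√2` for `k ≥ y`), so KEY ⟸ `x̃_m·S_m ≤ (1 − Ω_m − x̃_m)·v_m` with
`1 − Ω_m − x̃_m ≥ 0.29`.  NUMERICS of record (`g62/numerics/t14.py`, adversarial over coupling ratios, towers∕clusters∕2–5 ages, every truncation and pin):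
`x̃·S∕((1−Ω−x̃)v) ≤ 0.086` (the reduction costs a twelfth of the room), `S∕v ≤ 0.48` (supremum at a saturated OLD age with the young one idle, where `x̃ → 0`),
`x̃·S∕v ≤ 0.05`, `Ω + x̃ ≤ 0.55`, and the Harnack bound itself is sharp to 1e-4 near the truncation depth.  WHAT REMAINS for route (N) is the HARNACK-LOAD
LEMMA «`x̃_m·Σ_k θ̂_k(m;y) d_k(m) ≤ 0.29·v_m`» — README: for NEAR old ages `d_k∕v ≤ x̃_k∕(1−x̃_k)` and budget competition with `x̃_y` suffice (two ages close by
hand, max ≈ 0.85 of the room); for FAR blocks `θ̂_k ≈ 2y∕k` is small but `d_k∕v` grows like the inverse product of the younger blocks' survival factors —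
the lemma is the statement «absorption requires separation» (`(1 − u_t)·k_t∕k_{t−1} ≳ 1`), true on every flow computed, not yet a theorem.  NOT CLAIMED: the
Harnack-load lemma; KEY for the flow; (E58′); anything nonlinear; anything printed.

WHAT IS PROVED ([folklore]; 0 `def`, 0 sorry).  §1 `drop_split`, **`drop_shift_ge`** (persistence of a drop under a pin shift), `le_of_antitone_shift`.  §2
**`harnack_step`** (the `l`-step Harnack inequality).  §3 **`window_max_le`** (`(1−Ω_m)·max_window v ≤ v_m + S_m`), **`key_of_harnack_load`** (KEY at the pin
`m` from `x̃_m(v_m + S_m) ≤ (1−Ω_m)v_m`).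
-/
noncomputable section
open Finset

namespace Summit.QuantumFields.BalabanUV.Beta.EriceRemainderEnclosureHistoryAutonomyComparisonAgeCompositionHarnack

variable {N A y : ℕ} {E : ℕ → ℕ → ℕ → ℝ} {θ : ℕ → ℕ → ℕ → ℝ} {Ky : ℕ → ℕ → ℝ} {v w : ℕ → ℝ}

/-! ## §1 Drops of the old ages, split at a lag -/

/-- Splitting an age's drop at the lag `l`: `Σ_{i<N} E k m i·v(m+1+i) = Σ_{i<N, i<l} … + Σ_{i<N, l≤i} …`. [folklore] -/
theorem drop_split (E : ℕ → ℕ → ℕ → ℝ) (v : ℕ → ℝ) (k m l : ℕ) :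
    ∑ i ∈ range N, E k m i * v (m + 1 + i) =
      ∑ i ∈ (range N).filter (· < l), E k m i * v (m + 1 + i) + ∑ i ∈ (range N).filter (l ≤ ·), E k m i * v (m + 1 + i) := by
  rw [← sum_filter_add_sum_filter_not (range N) (· < l)]
  congr 1
  exact sum_congr (by ext i; simp [not_lt]) fun _ _ => rfl

/-- **PERSISTENCE OF A DROP UNDER A PIN SHIFT.**  Non-negative read weights `E k m i` (age `k`, pin `m`, target `m+1+i`) vanishing for `i ≥ N`, `v ≥ 0`
below the pin, and the persistence of the weights on the common targets when the pin moves `l` steps deeper: `(1 − θ k m l)·E k m (i+l) ≤ E k (m+l) i`.  Then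
the drop at the deeper pin retains the part of the drop at `m` beyond the lag `l`: `(1 − θ k m l)·Σ_{i ≥ l} E k m i·v(m+1+i) ≤ Σ_i E k (m+l) i·v(m+l+1+i)`.
(For the affine-memory flow: `E k m i = (L_k h_{m+k}³∕2)·Π_{t=m+1+i}^{m+k} g_t` for `i < k`, and `1 − θ k m l = (h_{m+k+l}∕h_{m+k})³·Π_{t=m+k+1}^{m+k+l} g_t` —
coefficient decay times the extra damping.) [folklore] -/
theorem drop_shift_ge (hEN : ∀ k m i, N ≤ i → E k m i = 0) (hv0 : ∀ n, 0 ≤ v n)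
    {k m l : ℕ} (hpers : ∀ i, (1 - θ k m l) * E k m (i + l) ≤ E k (m + l) i) :
    (1 - θ k m l) * ∑ i ∈ (range N).filter (l ≤ ·), E k m i * v (m + 1 + i) ≤
      ∑ i ∈ range N, E k (m + l) i * v (m + l + 1 + i) := by
  -- reindex the left sum by `i = i' + l`, `i' < N`
  have hre : ∑ i ∈ (range N).filter (l ≤ ·), E k m i * v (m + 1 + i) = ∑ i' ∈ range N, E k m (i' + l) * v (m + l + 1 + i') := by
    rw [← sum_filter_add_sum_filter_not (range N) (fun i' => i' + l < N) (f := fun i' => E k m (i' + l) * v (m + l + 1 + i'))]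
    have hz : ∑ i' ∈ (range N).filter (fun i' => ¬ (i' + l < N)), E k m (i' + l) * v (m + l + 1 + i') = 0 :=
      sum_eq_zero fun i' hi' => by
        rw [mem_filter] at hi'
        rw [hEN k m (i' + l) (by omega), zero_mul]
    rw [hz, add_zero]
    refine sum_nbij' (fun i => i - l) (fun i' => i' + l) ?_ ?_ ?_ ?_ ?_
    · intro i hi; simp only [mem_filter, mem_range] at hi ⊢; omega
    · intro i' hi'; simp only [mem_filter, mem_range] at hi' ⊢; omega
    · intro i hi; simp only [mem_filter, mem_range] at hi; omega
    · intro i' hi'; omega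
    · intro i hi; simp only [mem_filter, mem_range] at hi
      have h1 : i - l + l = i := by omega
      have h2 : m + l + 1 + (i - l) = m + 1 + i := by omega
      rw [h1, h2]
  rw [hre, mul_sum]
  exact sum_le_sum fun i' _ => by
    have := mul_le_mul_of_nonneg_right (hpers i') (hv0 (m + l + 1 + i'))
    linarith [mul_assoc (1 - θ k m l) (E k m (i' + l)) (v (m + l + 1 + i'))]

/-- A non-increasing sequence is non-increasing under shifts: `w (m + l) ≤ w m`. [folklore] -/
theorem le_of_antitone_shift (hw : ∀ n, w (n + 1) ≤ w n) (m l : ℕ) : w (m + l) ≤ w m := by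
  induction l with
  | zero => simp
  | succ l ih => exact (by rw [← add_assoc]; exact hw _ : w (m + (l + 1)) ≤ w (m + l)).trans ih

/-! ## §2 The `l`-step Harnack inequality for the old surplus -/

/-- **THE `l`-STEP HARNACK INEQUALITY.**  Old ages `k < A` with read weights `E` as in `drop_shift_ge`, persistence defects `θ k m l ≥ 0`; the old surplus
`v ≥ 0` with `v n = w n − Σ_{k<A} Σ_i E k n i·v(n+1+i)` for every `n` and a NON-INCREASING input `w`.  Then moving the pin `l` steps deeper raises the
surplus by at most the old reads INSIDE the first `l` lags plus the defect-weighted drops beyond: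
`v(m+l) ≤ v m + Σ_k Σ_{i<l} E k m i·v(m+1+i) + Σ_k θ k m l·Σ_{i≥l} E k m i·v(m+1+i)`. [folklore] -/
theorem harnack_step (hEN : ∀ k m i, N ≤ i → E k m i = 0)
    (hv0 : ∀ n, 0 ≤ v n) (hw : ∀ n, w (n + 1) ≤ w n)
    (heq : ∀ n, v n = w n - ∑ k ∈ range A, ∑ i ∈ range N, E k n i * v (n + 1 + i))
    {m l : ℕ} (hpers : ∀ k, k < A → ∀ i, (1 - θ k m l) * E k m (i + l) ≤ E k (m + l) i) :
    v (m + l) ≤ v m + ∑ k ∈ range A, ∑ i ∈ (range N).filter (· < l), E k m i * v (m + 1 + i)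
      + ∑ k ∈ range A, θ k m l * ∑ i ∈ (range N).filter (l ≤ ·), E k m i * v (m + 1 + i) := by
  have hwl : w (m + l) ≤ w m := le_of_antitone_shift hw m l
  have hdeep : ∀ k ∈ range A, (1 - θ k m l) * ∑ i ∈ (range N).filter (l ≤ ·), E k m i * v (m + 1 + i) ≤
      ∑ i ∈ range N, E k (m + l) i * v (m + l + 1 + i) :=
    fun k hk => drop_shift_ge hEN hv0 (hpers k (mem_range.mp hk))
  have h1 := heq (m + l)
  have h2 := heq m
  have hsplit : ∑ k ∈ range A, ∑ i ∈ range N, E k m i * v (m + 1 + i) =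
      ∑ k ∈ range A, ∑ i ∈ (range N).filter (· < l), E k m i * v (m + 1 + i) +
      ∑ k ∈ range A, ∑ i ∈ (range N).filter (l ≤ ·), E k m i * v (m + 1 + i) := by
    rw [← sum_add_distrib]; exact sum_congr rfl fun k _ => drop_split E v k m l
  have hsum : ∑ k ∈ range A, (1 - θ k m l) * ∑ i ∈ (range N).filter (l ≤ ·), E k m i * v (m + 1 + i) ≤
      ∑ k ∈ range A, ∑ i ∈ range N, E k (m + l) i * v (m + l + 1 + i) := sum_le_sum hdeep
  have hexp : ∑ k ∈ range A, (1 - θ k m l) * ∑ i ∈ (range N).filter (l ≤ ·), E k m i * v (m + 1 + i) =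
      ∑ k ∈ range A, ∑ i ∈ (range N).filter (l ≤ ·), E k m i * v (m + 1 + i) -
      ∑ k ∈ range A, θ k m l * ∑ i ∈ (range N).filter (l ≤ ·), E k m i * v (m + 1 + i) := by
    rw [← sum_sub_distrib]; exact sum_congr rfl fun k _ => by ring
  linarith

/-! ## §3 KEY from the Harnack load -/

/-- **THE WINDOW MAXIMUM.**  In the setting of `harnack_step` with defects non-decreasing in the shift (`θ k m l ≤ θ k m y` for `l ≤ y`), let `V` bound the old
surplus on the young window, `v(m+l) ≤ V` for `1 ≤ l ≤ y`, and be attained there.  Then `(1 − Ω_m)·V ≤ v m + S_m` with the OLD MASS INSIDE THE YOUNG WINDOW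
`Ω_m = Σ_k Σ_{i<y} E k m i` and the HARNACK LOAD `S_m = Σ_k θ k m y·(Σ_i E k m i·v(m+1+i))` (defect-weighted old drops). [folklore] -/
theorem window_max_le (hE0 : ∀ k m i, 0 ≤ E k m i) (hEN : ∀ k m i, N ≤ i → E k m i = 0) (hθ0 : ∀ k m l, 0 ≤ θ k m l)
    (hv0 : ∀ n, 0 ≤ v n) (hw : ∀ n, w (n + 1) ≤ w n)
    (heq : ∀ n, v n = w n - ∑ k ∈ range A, ∑ i ∈ range N, E k n i * v (n + 1 + i))
    {m : ℕ} (hpers : ∀ k, k < A → ∀ l, 1 ≤ l → l ≤ y → ∀ i, (1 - θ k m l) * E k m (i + l) ≤ E k (m + l) i)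
    (hθmono : ∀ k l, 1 ≤ l → l ≤ y → θ k m l ≤ θ k m y)
    {V : ℝ} (hV : ∀ l, 1 ≤ l → l ≤ y → v (m + l) ≤ V) (hVeq : ∃ l, 1 ≤ l ∧ l ≤ y ∧ v (m + l) = V) :
    (1 - ∑ k ∈ range A, ∑ i ∈ (range N).filter (· < y), E k m i) * V ≤
      v m + ∑ k ∈ range A, θ k m y * ∑ i ∈ range N, E k m i * v (m + 1 + i) := by
  obtain ⟨l, hl1, hly, hlV⟩ := hVeq
  have hH := harnack_step hEN hv0 hw heq (l := l) (fun k hk i => hpers k hk l hl1 hly i)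
  rw [hlV] at hH
  have hV0 : 0 ≤ V := by rw [← hlV]; exact hv0 _
  -- reads inside the first `l` lags ≤ (mass inside the young window) · V
  have hin : ∑ k ∈ range A, ∑ i ∈ (range N).filter (· < l), E k m i * v (m + 1 + i) ≤
      (∑ k ∈ range A, ∑ i ∈ (range N).filter (· < y), E k m i) * V := by
    rw [sum_mul]
    refine sum_le_sum fun k _ => ?_
    rw [sum_mul]
    calc ∑ i ∈ (range N).filter (· < l), E k m i * v (m + 1 + i)
        ≤ ∑ i ∈ (range N).filter (· < l), E k m i * V :=
          sum_le_sum fun i hi => by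
            rw [mem_filter] at hi
            have : v (m + 1 + i) ≤ V := by
              have := hV (1 + i) (by omega) (by omega); rwa [← add_assoc] at this
            exact mul_le_mul_of_nonneg_left this (hE0 k m i)
      _ ≤ ∑ i ∈ (range N).filter (· < y), E k m i * V :=
          sum_le_sum_of_subset_of_nonneg (fun i hi => by
              simp only [mem_filter, mem_range] at hi ⊢; omega)
            fun i _ _ => mul_nonneg (hE0 k m i) hV0
  -- defect-weighted tails ≤ θ(m,y)-weighted full drops
  have htail : ∑ k ∈ range A, θ k m l * ∑ i ∈ (range N).filter (l ≤ ·), E k m i * v (m + 1 + i) ≤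
      ∑ k ∈ range A, θ k m y * ∑ i ∈ range N, E k m i * v (m + 1 + i) :=
    sum_le_sum fun k hk => by
      have hdk : 0 ≤ ∑ i ∈ range N, E k m i * v (m + 1 + i) := sum_nonneg fun i _ => mul_nonneg (hE0 k m i) (hv0 _)
      have hsub : ∑ i ∈ (range N).filter (l ≤ ·), E k m i * v (m + 1 + i) ≤ ∑ i ∈ range N, E k m i * v (m + 1 + i) :=
        sum_le_sum_of_subset_of_nonneg (filter_subset _ _) fun i _ _ => mul_nonneg (hE0 k m i) (hv0 _)
      have htl : 0 ≤ ∑ i ∈ (range N).filter (l ≤ ·), E k m i * v (m + 1 + i) := sum_nonneg fun i _ => mul_nonneg (hE0 k m i) (hv0 _)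
      calc θ k m l * ∑ i ∈ (range N).filter (l ≤ ·), E k m i * v (m + 1 + i)
          ≤ θ k m y * ∑ i ∈ (range N).filter (l ≤ ·), E k m i * v (m + 1 + i) :=
            mul_le_mul_of_nonneg_right (hθmono k l hl1 hly) htl
        _ ≤ θ k m y * ∑ i ∈ range N, E k m i * v (m + 1 + i) :=
            mul_le_mul_of_nonneg_left hsub ((hθ0 k m l).trans (hθmono k l hl1 hly))
  nlinarith

/-- **KEY FROM THE HARNACK LOAD.**  In the setting of `window_max_le`, a NON-NEGATIVE young kernel `Ky m l'` supported on the lags `l' < y` (the young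
window) with damped load `x̃_m = Σ_{l'} Ky m l'`.  If the old mass inside the young window is `< 1` and the HARNACK-LOAD INEQUALITY
`x̃_m·(v m + S_m) ≤ (1 − Ω_m)·v m` holds — for the flow: `Ω_m + x̃_m ≤ √2∕2` by (E65a)'s window budget at the young scale, so it suffices that
`x̃_m·S_m ≤ (1 − Ω_m − x̃_m)·v m` with `1 − Ω_m − x̃_m ≥ 1 − √2∕2` — then KEY holds at the pin `m`: the young read of the old surplus is below its pin value,
`Σ_{l'} Ky m l'·v(m+1+l') ≤ v m`.  Numerics of record (`HOME/b2b-balaban-beta-d4-p2/g62/numerics/t14.py`): `x̃·S∕((1−Ω−x̃)·v) ≤ 0.09` over every flow tested.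
[folklore] -/
theorem key_of_harnack_load (hE0 : ∀ k m i, 0 ≤ E k m i) (hEN : ∀ k m i, N ≤ i → E k m i = 0) (hθ0 : ∀ k m l, 0 ≤ θ k m l)
    (hv0 : ∀ n, 0 ≤ v n) (hw : ∀ n, w (n + 1) ≤ w n)
    (heq : ∀ n, v n = w n - ∑ k ∈ range A, ∑ i ∈ range N, E k n i * v (n + 1 + i))
    {m : ℕ} (hpers : ∀ k, k < A → ∀ l, 1 ≤ l → l ≤ y → ∀ i, (1 - θ k m l) * E k m (i + l) ≤ E k (m + l) i)
    (hθmono : ∀ k l, 1 ≤ l → l ≤ y → θ k m l ≤ θ k m y)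
    (hKy0 : ∀ l', 0 ≤ Ky m l') (hKysupp : ∀ l', y ≤ l' → Ky m l' = 0) (hy : 1 ≤ y)
    (hΩ : ∑ k ∈ range A, ∑ i ∈ (range N).filter (· < y), E k m i < 1)
    (hstar : (∑ l' ∈ range N, Ky m l') * (v m + ∑ k ∈ range A, θ k m y * ∑ i ∈ range N, E k m i * v (m + 1 + i)) ≤
      (1 - ∑ k ∈ range A, ∑ i ∈ (range N).filter (· < y), E k m i) * v m) :
    ∑ l' ∈ range N, Ky m l' * v (m + 1 + l') ≤ v m := by
  -- the window maximum `V` over `1 ≤ l ≤ y`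
  obtain ⟨l₀, hl₀mem, hl₀max⟩ := exists_max_image (Icc 1 y) (fun l => v (m + l)) ⟨1, by simp [hy]⟩
  set V := v (m + l₀) with hVdef
  have hl₀ : 1 ≤ l₀ ∧ l₀ ≤ y := by simpa [mem_Icc] using hl₀mem
  have hV : ∀ l, 1 ≤ l → l ≤ y → v (m + l) ≤ V := fun l h1 h2 => hl₀max l (by simp [mem_Icc, h1, h2])
  have hwin := window_max_le hE0 hEN hθ0 hv0 hw heq hpers hθmono hV ⟨l₀, hl₀.1, hl₀.2, rfl⟩
  -- young read ≤ x̃ · V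
  have hread : ∑ l' ∈ range N, Ky m l' * v (m + 1 + l') ≤ (∑ l' ∈ range N, Ky m l') * V := by
    rw [sum_mul]
    exact sum_le_sum fun l' hl' => by
      by_cases hly : l' < y
      · have : v (m + 1 + l') ≤ V := by have := hV (1 + l') (by omega) (by omega); rwa [← add_assoc] at this
        exact mul_le_mul_of_nonneg_left this (hKy0 l')
      · rw [hKysupp l' (not_lt.mp hly)]; simp
  set Ω := ∑ k ∈ range A, ∑ i ∈ (range N).filter (· < y), E k m i
  set S := ∑ k ∈ range A, θ k m y * ∑ i ∈ range N, E k m i * v (m + 1 + i)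
  set x := ∑ l' ∈ range N, Ky m l'
  have hx0 : 0 ≤ x := sum_nonneg fun l' _ => hKy0 l'
  -- x·V ≤ x·(v + S)/(1 − Ω) ≤ v
  have h1 : (1 - Ω) * (x * V) ≤ x * (v m + S) := by nlinarith
  have h2 : (1 - Ω) * (x * V) ≤ (1 - Ω) * v m := h1.trans hstar
  have h3 : x * V ≤ v m := le_of_mul_le_mul_left h2 (by linarith)
  exact hread.trans h3

end Summit.QuantumFields.BalabanUV.Beta.EriceRemainderEnclosureHistoryAutonomyComparisonAgeCompositionHarnack

end
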